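/-
Copyright (c) 2026 the pub-hodgecm-mathlib formalisation cell (harness21).  Prover seat hodgecm-mathlib-K2E4-p11 (g2), Track B ∕ K2-LIT
(build stream 29), h413 = `stmt-HodgeConjecture-24833`, engine E2 line `K2_E2_ThetaExhaustionByRigidity`, unit CAPTURE, socket #20a
«ARCH-PAIR-HOLCOT» — helper H4b «ORIENTATION MIRROR», ASSEMBLY (deal K2E2-plan (g2) 2026-09-04T00:22:30Z; head of record = line lead K2E2-p12 (g2)
00:49:11Z «#20a-CAN → #20a-NONCAN»).  2026-09-04.
-/
import Summits.HodgeConjecture.HodgeConjecture.Theorems.K2E2CapArchPairFrameTransport     -- ★ p856071 (this seat): H2 `capArchPairHolCot_frameTransport` (+ the #20a vocabulary)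
import Summits.HodgeConjecture.HodgeConjecture.Theorems.K2E2CapArchPairMirrorKit          -- ★ p856262 (K2E2-p13): H4a `thetaLift_conj_cosetCongr_apply_map`, `arch_neg`
import Summits.HodgeConjecture.HodgeConjecture.Theorems.K2E2CapArchPairMirrorGlue         -- ★ p856259 (this seat): `adelic_JW_neg_eq`, `subgroupCongr_JW_neg_mem_range_iff`, `charCM_chiQuot_neg_conj_apply`, …
import Summits.HodgeConjecture.HodgeConjecture.Theorems.K2E2CapArchPairMirrorAtPKG        -- ★ p856852 (K2E2-p13): H4b-K `lineThetaKernelDatum_mirror_thetaFun` (K1), `archWeilRep_line_schwartzConj_eq_self_of_partner` (K2)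
import Summits.HodgeConjecture.HodgeConjecture.Theorems.F0P2OccGenCotangentOfOccursIn     -- ★ the PACKAGED frame `hermSpace3Of` (`frameD ∕ frameG ∕ frame_congr` of `HodgeCM.Model`)
import Summits.HodgeConjecture.HodgeConjecture.Theorems.F0P2sThetaOccursInGenOriented     -- ★ `conjTranspose_conjFrame_mul`, `posDef_off_embedding`, `cmArchSection_eq_conjU21`, `cmCompactFactor_eq_of_embedding`
import Literature.NumberTheory.Automorphic.UnitaryGroupCohomologicalFormsConjPullback       -- ★ `conjFun_comp_mem_holCotForms_of_conj`
import Literature.NumberTheory.Automorphic.Liu2021.ThetaLiftFromLineMajorantsOfFrame       -- ★ `hasThetaMajorants_lineThetaKernelDatum_of_frame`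
import Literature.MeasureTheory.Group.CosetSpaceLpTransport                                 -- ★ `cosetCongr` measures: `smulInvariantMeasure_map_cosetCongr_of_smulInvariantMeasure`, `isOpenPosMeasure_map_cosetCongr`
import HarnessLib

-- As in the lineage: the theta-kernel datum's types are very large; elaborate sequentially.
set_option Elab.async false

/-!
# K2 ∕ E2 «ThetaExhaustionByRigidity», unit CAPTURE, socket #20a — H4b «ORIENTATION MIRROR»: the NON-CANONICAL case of «ARCH-PAIR-HOLCOT» from the CANONICAL one

Cell `hodgecm-mathlib` (FLOOR 0), Track B «K2-LIT», engine E2, crux item H413 = `stmt-HodgeConjecture-24833` (route of record `HCCMUnconditional`, no route verbs).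
Socket of record: #20a `sig_K2E2CapArchPairHolCot` «ARCH-PAIR-HOLCOT» (bytes 3efc5e01); this file is the line lead's «H4b»: **`capArchPairHolCot_of_canonical :
«#20a-CAN» → «#20a-NONCAN»`** (texts `K2/K2E2-p12/g2/ARCH-PAIR-HOLCOT-{CAN,NONCAN}.txt` = the #20a bytes with `(InfinitePlace.mk ι).embedding = ι →` resp. `≠ ι →`
inserted after `2 ≤ [L⁺:ℚ] →`), so the CLOSER is `by_cases hemb; exact canonical …; exact capArchPairHolCot_of_canonical canonical … hemb`.  Author K2E4-p11 (g2).
`--supports stmt-HodgeConjecture-24833 --as helper`; THEOREMS ONLY; imports ★ only.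

THE PROOF ([Liu2021, App. D Lemma D.1 (2)]: «`ω(μ, ε, χ)` and `ω(μᶜ, −ε, χ̄)` are complex conjugate»).  For `ι` with `ι₀ := (mk ι).embedding ≠ ι` (so `ι₀ = ῑ`),
★ H2 reduces the tail to the PACKAGED frame `(e₁, frameD V, frameG V)` of `V := hermSpace3Of L ι H T`.  There: the partner frame `(ι₀, T̄)` is canonical
(★ `conjTranspose_conjFrame_mul`, `posDef_off_embedding`); the partner character `μ′` (weight one, CM type `Φ̄_μ`, so `ι₀ ∈ Φ_μ′` and `−a∕2δ` is `Φ_μ′`-admissible,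
★ `isAdmissibleElement_conj_neg_iff`) is the one of ★ `exists_weightOne_mirror_sChiD`, whose `χ`-attached splitting at `⟨−a⟩` IS the mirror of that of `μ` at
`⟨a⟩`; the `W`-side identification `e : U(⟨−a⟩)(𝔸) = U(⟨a⟩)(𝔸)` (★ glue) carries `μ_W` to `μ_W′ := (ē⁻¹)_* μ_W` (★ `cosetCongr`, finite ∕ invariant ∕ positive on
opens) and the weight `χ̃_χ` to `conj ∘ χ̃_{χ̄} ∘ ē⁻¹` (★ glue `charCM_chiQuot_neg_conj_apply`).  The CANONICAL clause for `(ι₀, T̄, μ′, −a, χ̄, μ_W′)` gives `φ′, j₀`;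
by H4a's conjugate transport ★ `thetaLift_conj_cosetCongr_apply_map` fed with the kernel law ★ `lineThetaKernelDatum_mirror_thetaFun` (H4b-K), the theta pair of
`(C_∞ φ′_j, Φ_f)` for `(μ, a, χ)` is the complex conjugate of the partner's pair of `(φ′_j, C_f Φ_f)`, a holomorphic cotangent form at `(ι₀, T̄)`, hence
(★ `conjFun_comp_mem_holCotForms_of_conj`, `cmArchSection_eq_conjU21`, `cmCompactFactor_eq_of_embedding`) a holomorphic cotangent form at `(ι, T)`;
`R^∞(C_∞φ′_{j₀}) = C_∞(R^∞φ′_{j₀}) ≠ 0`; and (E) is ★ `archWeilRep_line_schwartzConj_eq_self_of_partner` (H4b-K over H4a §2).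

HONEST LABEL.  HC_CM is proved only modulo the 7 printed citations (2 remaining named inputs: hLiu418 = stmt-HodgeConjecture-24832, h413 = stmt-HodgeConjecture-24833)
until rung 0 closes; this file closes nothing by itself (the CLOSER pays #20a with BOTH halves).

## References
* [Liu2021] Y. Liu, Camb. J. Math. 9 (2021) = arXiv:2102.11518: Def. 4.11–4.12; App. D §D.1 Steps 1–3, Lemma D.1 (2) (l. 5231); proof of Prop. 4.13 («Conversely»).
* [Li1992] J.-S. Li, J. reine angew. Math. 428 (1992), p. 181 (complex-conjugate theta kernels).
* [GelbartRogawski1991] S. Gelbart, J. Rogawski, Invent. Math. 105 (1991), §3.1 Prop. 3.1.1 p. 455, Remark p. 457.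
* [BorelWallach2000] A. Borel, N. Wallach, 2nd ed. (2000), VII 2.10 (Hodge types; conjugation swaps holomorphic and antiholomorphic).
-/

set_option autoImplicit false
set_option linter.dupNamespace false

noncomputable section

namespace Summit.HodgeConjecture.HodgeConjecture.Cruxes.H413.K2E2CapArchPairMirror

open scoped TensorProduct Matrix Kronecker ComplexOrder ENNReal SchwartzMap Classical Pointwise ComplexConjugate
open NumberField NumberField.InfinitePlace NumberField.ComplexEmbedding NumberField.mixedEmbedding IsDedekindDomain MeasureTheory MulAction
open Literature.NumberTheory Literature.NumberTheory.Automorphic Literature.NumberTheory.Automorphic.UnitaryGroup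
open Literature.NumberTheory.Automorphic.UnitaryGroup.CotangentForms
open Literature.NumberTheory.Automorphic.Liu2021
open Literature.NumberTheory.Automorphic.Liu2021.Def411WeilCarriers
open Literature.NumberTheory.Automorphic.Liu2021.Def411WeilCarriersDoubling
open Literature.NumberTheory.Automorphic.IdeleClassGroup
open Literature.NumberTheory.GelbartRogawski1991 Literature.NumberTheory.GelbartRogawski1991.UnitaryDualPair
open Literature.NumberTheory.GelbartRogawski1991.UnitaryDualPair.WeilCoinv
open Literature.NumberTheory.GelbartRogawski1991.GRConstruction
open Literature.NumberTheory.Weil1964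
open Literature.NumberTheory.ComplexMultiplication.CMTypeOps (bar mem_bar_iff conjugate_mem_iff_notMem)
open Literature.RepresentationTheory Literature.RepresentationTheory.Liu2021
open Literature.RepresentationTheory.CompactGroups
open Literature.MeasureTheory.Group
open Literature.Geometry.ComplexHyperbolic.BallModel (U21 x₀ conjU21)
open Literature.AlgebraicGeometry.Liu2021 (IsAdmissibleElement isAdmissibleElement_conj_neg_iff)
open Summit.HodgeConjecture.CorCM
open Summit.HodgeConjecture.CorCM.Transposition
open Summit.HodgeConjecture.HodgeConjecture.Cruxes.H413
open Summit.HodgeConjecture.HodgeConjecture.Cruxes.H413.F0P2sThetaOccursInGenOriented (conjTranspose_conjFrame_mul posDef_off_embedding cmArchSection_eq_conjU21 cmCompactFactor_eq_of_embedding)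

set_option synthInstance.maxHeartbeats 400000 in
set_option maxHeartbeats 16000000 in  -- as ★ `K2E2CapArchRowsAllDataOfPairHolCot` ∕ ★ H2: the #20a statement alone exceeds 1 600 000
/-- **H4b «ORIENTATION MIRROR»: the #20a clause at the NEGATIVELY oriented representatives from the clause at the POSITIVELY oriented ones** —
`«#20a-CAN» → «#20a-NONCAN»` (the #20a bytes with `(mk ι).embedding = ι →` resp. `≠ ι →` after `2 ≤ [L⁺:ℚ] →`): at `(ι, T)` with `(mk ι).embedding ≠ ι` the
theta pairs of `(μ, ⟨a⟩, χ)` are the complex conjugates of those of the partner `(μ′, ⟨−a⟩, χ̄)` read at the canonical frame `((mk ι).embedding, T̄)`, and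
conjugation carries holomorphic cotangent forms at `((mk ι).embedding, T̄)` to holomorphic cotangent forms at `(ι, T)`.
[cite: Liu2021, App. D Lemma D.1 (2) (l. 5231); Def. 4.11–4.12; proof of Prop. 4.13] [cite: Li1992, p. 181] [cite: GelbartRogawski1991, §3.1 Prop. 3.1.1 p. 455, Remark p. 457]
[cite: BorelWallach2000, VII 2.10] -/
theorem capArchPairHolCot_of_canonical
    (hcan : ∀ (L : Type) [Field L] [NumberField L] [IsCMField L] (ι : L →+* ℂ) (H : Matrix (Fin 3) (Fin 3) L) (T : GL (Fin 3) ℂ)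
        (hT : (T : Matrix (Fin 3) (Fin 3) ℂ)ᴴ * H.map ι * (T : Matrix (Fin 3) (Fin 3) ℂ) = Literature.Geometry.ComplexHyperbolic.BallModel.J),
        (∀ τ' : L →+* ℂ, InfinitePlace.mk τ' ≠ InfinitePlace.mk ι → (H.map τ').PosDef) → 2 ≤ Module.finrank ℚ ↥(maximalRealSubfield L) →
        (InfinitePlace.mk ι).embedding = ι →
        ∀ {n' : ℕ} (e₁ : Fin 3 × Fin 1 ≃ Fin n') (dV : Fin 3 → L) (hdV : ∀ i, IsCMField.complexConj L (dV i) = dV i)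
          (hdV0 : ∀ i, dV i ≠ 0) (g : GL (Fin 3) L)
          (hg : ((g : Matrix (Fin 3) (Fin 3) L).map (cmConjRingHom L))ᵀ * H * (g : Matrix (Fin 3) (Fin 3) L) = Matrix.diagonal dV)
          (ιV : finAdelic (↥(maximalRealSubfield L)) L (IsCMField.complexConj L) 3 H →*
              finAdelic (↥(maximalRealSubfield L)) L (IsCMField.complexConj L) 3 (Matrix.diagonal dV)),
            (∀ k, ((ιV k : finAdelic (↥(maximalRealSubfield L)) L (IsCMField.complexConj L) 3 (Matrix.diagonal dV)) :
                GL (Fin 3) (FiniteAdeleRing (𝓞 L) L)) =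
              (toFinAdeleGL L 3 g)⁻¹ * (k : GL (Fin 3) (FiniteAdeleRing (𝓞 L) L)) * toFinAdeleGL L 3 g) →
          ∀ [CompactSpace (↥(UnitaryGroup.adelic (↥(maximalRealSubfield L)) L (IsCMField.complexConj L) 3 (Matrix.diagonal dV)) ⧸
              (UnitaryGroup.toAdelic (↥(maximalRealSubfield L)) L (IsCMField.complexConj L) 3 (Matrix.diagonal dV)).range)],
          ∀ (μ : Literature.NumberTheory.Automorphic.IdeleClassGroup L →ₜ* Circle) (hμ : IsConjugateSymplectic L μ), HasWeight L μ 1 →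
            ι ∈ hμ.cmType.1 →
          ∀ (a : (↥(maximalRealSubfield L))ˣ) (χ : Chi (↥(maximalRealSubfield L)) L (IsCMField.complexConj L)),
              IsAdmissibleElement L hμ.cmType.1 (algebraMap (↥(maximalRealSubfield L)) L a * (2 * imagUnit L)⁻¹) →
              ∀ (hρ : HasThetaMajorants fun
                  (p : ↥(UnitaryGroup.adelic (↥(maximalRealSubfield L)) L (IsCMField.complexConj L) 3 (Matrix.diagonal dV)) ×
                    ↥(UnitaryGroup.adelic (↥(maximalRealSubfield L)) L (IsCMField.complexConj L) 1 (JW (↥(maximalRealSubfield L)) L a)))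
                  (Φ : piSchwartzBruhat (↥(maximalRealSubfield L)) (Fin n')) =>
                    pairRep (↥(maximalRealSubfield L)) L (IsCMField.complexConj L) 3 1 e₁ (Matrix.diagonal dV) (JW (↥(maximalRealSubfield L)) L a)
                      (chiSplittingLine L e₁ dV hdV hdV0 (toHeckeCharacter L μ) (isUnitary_toHeckeCharacter L μ)
                        ((isOscillatorChar_toHeckeCharacter_iff μ).mpr hμ) (TW (↥(maximalRealSubfield L)) a)
                        (isUnit_det_TW (↥(maximalRealSubfield L)) a) (JW (↥(maximalRealSubfield L)) L a) (JW_eq (↥(maximalRealSubfield L)) L a))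
                      p Φ)
                [MeasurableSpace (↥(UnitaryGroup.adelic (↥(maximalRealSubfield L)) L (IsCMField.complexConj L) 1
                    (JW (↥(maximalRealSubfield L)) L a)) ⧸
                      (UnitaryGroup.toAdelic (↥(maximalRealSubfield L)) L (IsCMField.complexConj L) 1 (JW (↥(maximalRealSubfield L)) L a)).range)]
                [BorelSpace (↥(UnitaryGroup.adelic (↥(maximalRealSubfield L)) L (IsCMField.complexConj L) 1
                    (JW (↥(maximalRealSubfield L)) L a)) ⧸
                      (UnitaryGroup.toAdelic (↥(maximalRealSubfield L)) L (IsCMField.complexConj L) 1 (JW (↥(maximalRealSubfield L)) L a)).range)]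
                (μW : Measure (↥(UnitaryGroup.adelic (↥(maximalRealSubfield L)) L (IsCMField.complexConj L) 1
                  (JW (↥(maximalRealSubfield L)) L a)) ⧸
                    (UnitaryGroup.toAdelic (↥(maximalRealSubfield L)) L (IsCMField.complexConj L) 1 (JW (↥(maximalRealSubfield L)) L a)).range))
                [IsFiniteMeasure μW]
                [SMulInvariantMeasure
                  (↥(UnitaryGroup.adelic (↥(maximalRealSubfield L)) L (IsCMField.complexConj L) 1 (JW (↥(maximalRealSubfield L)) L a)))
                  (↥(UnitaryGroup.adelic (↥(maximalRealSubfield L)) L (IsCMField.complexConj L) 1 (JW (↥(maximalRealSubfield L)) L a)) ⧸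
                    (UnitaryGroup.toAdelic (↥(maximalRealSubfield L)) L (IsCMField.complexConj L) 1 (JW (↥(maximalRealSubfield L)) L a)).range)
                  μW]
                [μW.IsOpenPosMeasure],
              ∃ (φ : Fin 2 → 𝓢(((Fin 3 × Fin 1) → NumberField.mixedEmbedding.mixedSpace ↥(maximalRealSubfield L)), ℂ)) (j₀ : Fin 2),
                  -- (HOLCOT) every theta pair of `φ` read on `U(H)(𝔸)` along the canonical transport is a HOLOMORPHIC COTANGENT FORM at `(ι, T)` …
                (haveI := normal_range_toAdelic_JW L a
                 ∀ (Φf : FinSB (↥(maximalRealSubfield L)) (Fin 3 × Fin 1)),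
                    ((fun (x : (adelicGroupData (↥(maximalRealSubfield L)) L (IsCMField.complexConj L) 3 H).Adelic) (j : Fin 2) =>
                      (lineThetaKernelDatum L 3 e₁ dV hdV hdV0 μ hμ a hρ).thetaLiftFun μW
                        (piSBReindex (↥(maximalRealSubfield L)) e₁
                          (piSchwartzBruhatEquiv (↥(maximalRealSubfield L)) (Fin 3 × Fin 1) (φ j ⊗ₜ[ℂ] Φf)))
                        (charCM (chiQuot (↥(maximalRealSubfield L)) L (IsCMField.complexConj L) (Algebra.IsQuadraticExtension.finrank_eq_two _ L)
                          (IsCMField.complexConj_ne_one (K := L)) a χ))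
                        ((cmAdelicFrameTransport L 3 H dV g hg) x))) ∈
                      CotangentForms.holCotForms (↥(maximalRealSubfield L)) L (IsCMField.complexConj L) 3 H
                        (cmArchSection L ι H T hT) (cmCompactFactor L ι H T hT)) ∧
                  -- … the archimedean vector `R^∞_{e₁} φ_{j₀}` is non-zero …
                schwartzReindexCLM (↥(maximalRealSubfield L)) e₁ (φ j₀) ≠ 0 ∧
                  -- (E) … and FIXED by `U(⟨a⟩)(L⁺ ⊗ ℝ)` under the archimedean Weil representation at the `μ`-splitting
                (∀ a' : UnitaryGroup.arch (↥(maximalRealSubfield L)) L (IsCMField.complexConj L) 1 (JW (↥(maximalRealSubfield L)) L a),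
                  HodgeCM.Model.HypCensus.archWeilRep (↥(maximalRealSubfield L)) L (IsCMField.complexConj L) 3 1 (Matrix.diagonal dV)
                    (JW (↥(maximalRealSubfield L)) L a) (complexConj_imagUnit L) (imagUnit_ne_zero L) (imagUnit_mul_self L) (realDiagonal_isSymm L dV hdV)
                    (isSymm_TW (↥(maximalRealSubfield L)) a) (isUnit_det_realDiagonal L dV hdV hdV0) (isUnit_det_TW (↥(maximalRealSubfield L)) a)
                    (realDiagonal_map L dV hdV).symm (JW_eq (↥(maximalRealSubfield L)) L a) e₁
                    (chiSplittingLine L e₁ dV hdV hdV0 (toHeckeCharacter L μ) (isUnitary_toHeckeCharacter L μ)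
                      ((isOscillatorChar_toHeckeCharacter_iff μ).mpr hμ) (TW (↥(maximalRealSubfield L)) a)
                      (isUnit_det_TW (↥(maximalRealSubfield L)) a) (JW (↥(maximalRealSubfield L)) L a) (JW_eq (↥(maximalRealSubfield L)) L a))
                    (ThetaNonvanishing.proj_apply_eq_toSp (↥(maximalRealSubfield L)) L (IsCMField.complexConj L) 3 1 e₁ (Matrix.diagonal dV)
                      (JW (↥(maximalRealSubfield L)) L a) (complexConj_imagUnit L) (imagUnit_ne_zero L) (imagUnit_mul_self L) (realDiagonal_isSymm L dV hdV)
                      (isSymm_TW (↥(maximalRealSubfield L)) a) (isUnit_det_realDiagonal L dV hdV hdV0) (isUnit_det_TW (↥(maximalRealSubfield L)) a)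
                      (realDiagonal_map L dV hdV).symm (JW_eq (↥(maximalRealSubfield L)) L a)
                      (isCompatible_chiSplittingLine L e₁ dV hdV hdV0 (toHeckeCharacter L μ) (isUnitary_toHeckeCharacter L μ)
                        ((isOscillatorChar_toHeckeCharacter_iff μ).mpr hμ) (TW (↥(maximalRealSubfield L)) a) (isSymm_TW (↥(maximalRealSubfield L)) a)
                        (isUnit_det_TW (↥(maximalRealSubfield L)) a) (JW (↥(maximalRealSubfield L)) L a) (JW_eq (↥(maximalRealSubfield L)) L a)))
                    (1, a') (schwartzReindexCLM (↥(maximalRealSubfield L)) e₁ (φ j₀)) = schwartzReindexCLM (↥(maximalRealSubfield L)) e₁ (φ j₀))) :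
      ∀ (L : Type) [Field L] [NumberField L] [IsCMField L] (ι : L →+* ℂ) (H : Matrix (Fin 3) (Fin 3) L) (T : GL (Fin 3) ℂ)
        (hT : (T : Matrix (Fin 3) (Fin 3) ℂ)ᴴ * H.map ι * (T : Matrix (Fin 3) (Fin 3) ℂ) = Literature.Geometry.ComplexHyperbolic.BallModel.J),
        (∀ τ' : L →+* ℂ, InfinitePlace.mk τ' ≠ InfinitePlace.mk ι → (H.map τ').PosDef) → 2 ≤ Module.finrank ℚ ↥(maximalRealSubfield L) →
        (InfinitePlace.mk ι).embedding ≠ ι →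
        ∀ {n' : ℕ} (e₁ : Fin 3 × Fin 1 ≃ Fin n') (dV : Fin 3 → L) (hdV : ∀ i, IsCMField.complexConj L (dV i) = dV i)
          (hdV0 : ∀ i, dV i ≠ 0) (g : GL (Fin 3) L)
          (hg : ((g : Matrix (Fin 3) (Fin 3) L).map (cmConjRingHom L))ᵀ * H * (g : Matrix (Fin 3) (Fin 3) L) = Matrix.diagonal dV)
          (ιV : finAdelic (↥(maximalRealSubfield L)) L (IsCMField.complexConj L) 3 H →*
              finAdelic (↥(maximalRealSubfield L)) L (IsCMField.complexConj L) 3 (Matrix.diagonal dV)),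
            (∀ k, ((ιV k : finAdelic (↥(maximalRealSubfield L)) L (IsCMField.complexConj L) 3 (Matrix.diagonal dV)) :
                GL (Fin 3) (FiniteAdeleRing (𝓞 L) L)) =
              (toFinAdeleGL L 3 g)⁻¹ * (k : GL (Fin 3) (FiniteAdeleRing (𝓞 L) L)) * toFinAdeleGL L 3 g) →
          ∀ [CompactSpace (↥(UnitaryGroup.adelic (↥(maximalRealSubfield L)) L (IsCMField.complexConj L) 3 (Matrix.diagonal dV)) ⧸
              (UnitaryGroup.toAdelic (↥(maximalRealSubfield L)) L (IsCMField.complexConj L) 3 (Matrix.diagonal dV)).range)],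
          ∀ (μ : Literature.NumberTheory.Automorphic.IdeleClassGroup L →ₜ* Circle) (hμ : IsConjugateSymplectic L μ), HasWeight L μ 1 →
            ι ∈ hμ.cmType.1 →
          ∀ (a : (↥(maximalRealSubfield L))ˣ) (χ : Chi (↥(maximalRealSubfield L)) L (IsCMField.complexConj L)),
              IsAdmissibleElement L hμ.cmType.1 (algebraMap (↥(maximalRealSubfield L)) L a * (2 * imagUnit L)⁻¹) →
              ∀ (hρ : HasThetaMajorants fun
                  (p : ↥(UnitaryGroup.adelic (↥(maximalRealSubfield L)) L (IsCMField.complexConj L) 3 (Matrix.diagonal dV)) ×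
                    ↥(UnitaryGroup.adelic (↥(maximalRealSubfield L)) L (IsCMField.complexConj L) 1 (JW (↥(maximalRealSubfield L)) L a)))
                  (Φ : piSchwartzBruhat (↥(maximalRealSubfield L)) (Fin n')) =>
                    pairRep (↥(maximalRealSubfield L)) L (IsCMField.complexConj L) 3 1 e₁ (Matrix.diagonal dV) (JW (↥(maximalRealSubfield L)) L a)
                      (chiSplittingLine L e₁ dV hdV hdV0 (toHeckeCharacter L μ) (isUnitary_toHeckeCharacter L μ)
                        ((isOscillatorChar_toHeckeCharacter_iff μ).mpr hμ) (TW (↥(maximalRealSubfield L)) a)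
                        (isUnit_det_TW (↥(maximalRealSubfield L)) a) (JW (↥(maximalRealSubfield L)) L a) (JW_eq (↥(maximalRealSubfield L)) L a))
                      p Φ)
                [MeasurableSpace (↥(UnitaryGroup.adelic (↥(maximalRealSubfield L)) L (IsCMField.complexConj L) 1
                    (JW (↥(maximalRealSubfield L)) L a)) ⧸
                      (UnitaryGroup.toAdelic (↥(maximalRealSubfield L)) L (IsCMField.complexConj L) 1 (JW (↥(maximalRealSubfield L)) L a)).range)]
                [BorelSpace (↥(UnitaryGroup.adelic (↥(maximalRealSubfield L)) L (IsCMField.complexConj L) 1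
                    (JW (↥(maximalRealSubfield L)) L a)) ⧸
                      (UnitaryGroup.toAdelic (↥(maximalRealSubfield L)) L (IsCMField.complexConj L) 1 (JW (↥(maximalRealSubfield L)) L a)).range)]
                (μW : Measure (↥(UnitaryGroup.adelic (↥(maximalRealSubfield L)) L (IsCMField.complexConj L) 1
                  (JW (↥(maximalRealSubfield L)) L a)) ⧸
                    (UnitaryGroup.toAdelic (↥(maximalRealSubfield L)) L (IsCMField.complexConj L) 1 (JW (↥(maximalRealSubfield L)) L a)).range))
                [IsFiniteMeasure μW]
                [SMulInvariantMeasure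
                  (↥(UnitaryGroup.adelic (↥(maximalRealSubfield L)) L (IsCMField.complexConj L) 1 (JW (↥(maximalRealSubfield L)) L a)))
                  (↥(UnitaryGroup.adelic (↥(maximalRealSubfield L)) L (IsCMField.complexConj L) 1 (JW (↥(maximalRealSubfield L)) L a)) ⧸
                    (UnitaryGroup.toAdelic (↥(maximalRealSubfield L)) L (IsCMField.complexConj L) 1 (JW (↥(maximalRealSubfield L)) L a)).range)
                  μW]
                [μW.IsOpenPosMeasure],
              ∃ (φ : Fin 2 → 𝓢(((Fin 3 × Fin 1) → NumberField.mixedEmbedding.mixedSpace ↥(maximalRealSubfield L)), ℂ)) (j₀ : Fin 2),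
                  -- (HOLCOT) every theta pair of `φ` read on `U(H)(𝔸)` along the canonical transport is a HOLOMORPHIC COTANGENT FORM at `(ι, T)` …
                (haveI := normal_range_toAdelic_JW L a
                 ∀ (Φf : FinSB (↥(maximalRealSubfield L)) (Fin 3 × Fin 1)),
                    ((fun (x : (adelicGroupData (↥(maximalRealSubfield L)) L (IsCMField.complexConj L) 3 H).Adelic) (j : Fin 2) =>
                      (lineThetaKernelDatum L 3 e₁ dV hdV hdV0 μ hμ a hρ).thetaLiftFun μW
                        (piSBReindex (↥(maximalRealSubfield L)) e₁
                          (piSchwartzBruhatEquiv (↥(maximalRealSubfield L)) (Fin 3 × Fin 1) (φ j ⊗ₜ[ℂ] Φf)))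
                        (charCM (chiQuot (↥(maximalRealSubfield L)) L (IsCMField.complexConj L) (Algebra.IsQuadraticExtension.finrank_eq_two _ L)
                          (IsCMField.complexConj_ne_one (K := L)) a χ))
                        ((cmAdelicFrameTransport L 3 H dV g hg) x))) ∈
                      CotangentForms.holCotForms (↥(maximalRealSubfield L)) L (IsCMField.complexConj L) 3 H
                        (cmArchSection L ι H T hT) (cmCompactFactor L ι H T hT)) ∧
                  -- … the archimedean vector `R^∞_{e₁} φ_{j₀}` is non-zero …
                schwartzReindexCLM (↥(maximalRealSubfield L)) e₁ (φ j₀) ≠ 0 ∧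
                  -- (E) … and FIXED by `U(⟨a⟩)(L⁺ ⊗ ℝ)` under the archimedean Weil representation at the `μ`-splitting
                (∀ a' : UnitaryGroup.arch (↥(maximalRealSubfield L)) L (IsCMField.complexConj L) 1 (JW (↥(maximalRealSubfield L)) L a),
                  HodgeCM.Model.HypCensus.archWeilRep (↥(maximalRealSubfield L)) L (IsCMField.complexConj L) 3 1 (Matrix.diagonal dV)
                    (JW (↥(maximalRealSubfield L)) L a) (complexConj_imagUnit L) (imagUnit_ne_zero L) (imagUnit_mul_self L) (realDiagonal_isSymm L dV hdV)
                    (isSymm_TW (↥(maximalRealSubfield L)) a) (isUnit_det_realDiagonal L dV hdV hdV0) (isUnit_det_TW (↥(maximalRealSubfield L)) a)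
                    (realDiagonal_map L dV hdV).symm (JW_eq (↥(maximalRealSubfield L)) L a) e₁
                    (chiSplittingLine L e₁ dV hdV hdV0 (toHeckeCharacter L μ) (isUnitary_toHeckeCharacter L μ)
                      ((isOscillatorChar_toHeckeCharacter_iff μ).mpr hμ) (TW (↥(maximalRealSubfield L)) a)
                      (isUnit_det_TW (↥(maximalRealSubfield L)) a) (JW (↥(maximalRealSubfield L)) L a) (JW_eq (↥(maximalRealSubfield L)) L a))
                    (ThetaNonvanishing.proj_apply_eq_toSp (↥(maximalRealSubfield L)) L (IsCMField.complexConj L) 3 1 e₁ (Matrix.diagonal dV)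
                      (JW (↥(maximalRealSubfield L)) L a) (complexConj_imagUnit L) (imagUnit_ne_zero L) (imagUnit_mul_self L) (realDiagonal_isSymm L dV hdV)
                      (isSymm_TW (↥(maximalRealSubfield L)) a) (isUnit_det_realDiagonal L dV hdV hdV0) (isUnit_det_TW (↥(maximalRealSubfield L)) a)
                      (realDiagonal_map L dV hdV).symm (JW_eq (↥(maximalRealSubfield L)) L a)
                      (isCompatible_chiSplittingLine L e₁ dV hdV hdV0 (toHeckeCharacter L μ) (isUnitary_toHeckeCharacter L μ)
                        ((isOscillatorChar_toHeckeCharacter_iff μ).mpr hμ) (TW (↥(maximalRealSubfield L)) a) (isSymm_TW (↥(maximalRealSubfield L)) a)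
                        (isUnit_det_TW (↥(maximalRealSubfield L)) a) (JW (↥(maximalRealSubfield L)) L a) (JW_eq (↥(maximalRealSubfield L)) L a)))
                    (1, a') (schwartzReindexCLM (↥(maximalRealSubfield L)) e₁ (φ j₀)) = schwartzReindexCLM (↥(maximalRealSubfield L)) e₁ (φ j₀)) := by
  intro L _ _ _ ι H T hT hpos hdeg hne
  /- STEP 0: reduce to the PACKAGED frame by ★ H2 `capArchPairHolCot_frameTransport` -/
  refine K2E2CapArchPairFrameTransport.capArchPairHolCot_frameTransport L ι H T hT hpos hdeg HodgeCM.Model.ArchSideTerm.e₁ (HodgeCM.Model.frameD (F0P2OccGenCotangentOfOccursIn.hermSpace3Of L ι H T hT hpos)) (HodgeCM.Model.frameD_real (F0P2OccGenCotangentOfOccursIn.hermSpace3Of L ι H T hT hpos)) (HodgeCM.Model.frameD_ne (F0P2OccGenCotangentOfOccursIn.hermSpace3Of L ι H T hT hpos)) (HodgeCM.Model.frameG (F0P2OccGenCotangentOfOccursIn.hermSpace3Of L ι H T hT hpos)) (HodgeCM.Model.frame_congr (F0P2OccGenCotangentOfOccursIn.hermSpace3Of L ι H T hT hpos)) ?_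
  intro ιV hιV _instC μ hμ hw hι a χ hadm hρ _instM _instB μW _instF _instS _instO
  classical
  haveI hN := normal_range_toAdelic_JW L a
  haveI hN' := normal_range_toAdelic_JW L (-a)
  haveI hcW := compactSpace_quotient_range_toAdelic_JW L a
  haveI hcW' := compactSpace_quotient_range_toAdelic_JW L (-a)
  /- STEP 1: the partner frame `(ι₀, T̄)` — canonical at the place of `ι` -/
  have hT₀ := conjTranspose_conjFrame_mul L ι H T hT hne
  have hpos₀ := posDef_off_embedding L ι H hpos
  have hemb₀ : (InfinitePlace.mk (InfinitePlace.mk ι).embedding).embedding = (InfinitePlace.mk ι).embedding := by rw [InfinitePlace.mk_embedding]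
  /- STEP 2: the partner character `μ′` (weight one, CM type `Φ̄_μ`) and the mirror identity of the `χ`-attached splittings at the packaged frame -/
  obtain ⟨μ', hμ', hw', hΦ', hEq⟩ :=
    MirrorAtPinLine.exists_weightOne_mirror_sChiD (F0P2OccGenCotangentOfOccursIn.hermSpace3Of L ι H T hT hpos) μ hμ hw hμ.hasCMType_cmType a
  have hcm' : hμ'.cmType = bar hμ.cmType := hμ'.cmType_eq hΦ'
  have hι₀ : (InfinitePlace.mk ι).embedding ∈ hμ'.cmType.1 := by
    rw [hcm', mem_bar_iff, (InfinitePlace.embedding_mk_eq ι).resolve_left hne]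
    exact fun h => (conjugate_mem_iff_notMem hμ.cmType ι).1 h hι
  have hadm' : IsAdmissibleElement L hμ'.cmType.1 (algebraMap (↥(maximalRealSubfield L)) L (((-a : (↥(maximalRealSubfield L))ˣ)) : (↥(maximalRealSubfield L))) * (2 * imagUnit L)⁻¹) := by
    have hset : (hμ'.cmType).1 = {τ' | conjugate τ' ∈ hμ.cmType.1} := by
      rw [hcm']
      ext τ'
      rw [mem_bar_iff, Set.mem_setOf_eq, conjugate_mem_iff_notMem]
    rw [hset, Units.val_neg, map_neg, neg_mul]
    exact (isAdmissibleElement_conj_neg_iff _ _).2 hadm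
  /- STEP 3: the `W`-side identification `e : U(⟨−a⟩)(𝔸) ≃* U(⟨a⟩)(𝔸)` (identity on matrices), its quotient map and the transported measure -/
  have hneg := K2E2CapArchPairMirrorGlue.adelic_JW_neg_eq (↥(maximalRealSubfield L)) L (IsCMField.complexConj L) a
  have hΓ : ∀ y', MulEquiv.subgroupCongr hneg y' ∈ (UnitaryGroup.toAdelic (↥(maximalRealSubfield L)) L (IsCMField.complexConj L) 1 (JW (↥(maximalRealSubfield L)) L a)).range ↔ y' ∈ (UnitaryGroup.toAdelic (↥(maximalRealSubfield L)) L (IsCMField.complexConj L) 1 (JW (↥(maximalRealSubfield L)) L (-a))).range :=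
    K2E2CapArchPairMirrorGlue.subgroupCongr_JW_neg_mem_range_iff (↥(maximalRealSubfield L)) L (IsCMField.complexConj L) a
  have he : Continuous (MulEquiv.subgroupCongr hneg) := Literature.NumberTheory.Weil1964.continuous_subgroupCongr hneg
  have hes : Continuous (MulEquiv.subgroupCongr hneg).symm := K2E2CapArchPairMirrorGlue.continuous_subgroupCongr_symm hneg
  have hess : Continuous (MulEquiv.subgroupCongr hneg).symm.symm := by rw [MulEquiv.symm_symm]; exact he
  letI mW' : MeasurableSpace (↥(UnitaryGroup.adelic (↥(maximalRealSubfield L)) L (IsCMField.complexConj L) 1 (JW (↥(maximalRealSubfield L)) L (-a))) ⧸ (UnitaryGroup.toAdelic (↥(maximalRealSubfield L)) L (IsCMField.complexConj L) 1 (JW (↥(maximalRealSubfield L)) L (-a))).range) := borel _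
  haveI bW' : BorelSpace (↥(UnitaryGroup.adelic (↥(maximalRealSubfield L)) L (IsCMField.complexConj L) 1 (JW (↥(maximalRealSubfield L)) L (-a))) ⧸ (UnitaryGroup.toAdelic (↥(maximalRealSubfield L)) L (IsCMField.complexConj L) 1 (JW (↥(maximalRealSubfield L)) L (-a))).range) := ⟨rfl⟩
  have hΓ' := forall_symm_mem_iff (MulEquiv.subgroupCongr hneg) (UnitaryGroup.toAdelic (↥(maximalRealSubfield L)) L (IsCMField.complexConj L) 1 (JW (↥(maximalRealSubfield L)) L (-a))).range (UnitaryGroup.toAdelic (↥(maximalRealSubfield L)) L (IsCMField.complexConj L) 1 (JW (↥(maximalRealSubfield L)) L a)).range hΓ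
  -- the transported measure `μ_W′ := (ē⁻¹)_* μ_W` on `[U(⟨−a⟩)]`
  obtain ⟨μW', hμW'⟩ : ∃ μW' : Measure (↥(UnitaryGroup.adelic (↥(maximalRealSubfield L)) L (IsCMField.complexConj L) 1 (JW (↥(maximalRealSubfield L)) L (-a))) ⧸ (UnitaryGroup.toAdelic (↥(maximalRealSubfield L)) L (IsCMField.complexConj L) 1 (JW (↥(maximalRealSubfield L)) L (-a))).range),
      μW' = μW.map (cosetCongr (MulEquiv.subgroupCongr hneg).symm (UnitaryGroup.toAdelic (↥(maximalRealSubfield L)) L (IsCMField.complexConj L) 1 (JW (↥(maximalRealSubfield L)) L a)).range (UnitaryGroup.toAdelic (↥(maximalRealSubfield L)) L (IsCMField.complexConj L) 1 (JW (↥(maximalRealSubfield L)) L (-a))).range hΓ') := ⟨_, rfl⟩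
  haveI : IsFiniteMeasure μW' := by rw [hμW']; exact Measure.isFiniteMeasure_map μW _
  haveI : SMulInvariantMeasure ↥(UnitaryGroup.adelic (↥(maximalRealSubfield L)) L (IsCMField.complexConj L) 1 (JW (↥(maximalRealSubfield L)) L (-a))) (↥(UnitaryGroup.adelic (↥(maximalRealSubfield L)) L (IsCMField.complexConj L) 1 (JW (↥(maximalRealSubfield L)) L (-a))) ⧸ (UnitaryGroup.toAdelic (↥(maximalRealSubfield L)) L (IsCMField.complexConj L) 1 (JW (↥(maximalRealSubfield L)) L (-a))).range) μW' := by
    rw [hμW']; exact smulInvariantMeasure_map_cosetCongr_of_smulInvariantMeasure _ _ _ hΓ' hes μW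
  haveI : μW'.IsOpenPosMeasure := by
    rw [hμW']; exact isOpenPosMeasure_map_cosetCongr _ _ _ hΓ' hes hess μW
  have hback : μW'.map (cosetCongr (MulEquiv.subgroupCongr hneg) (UnitaryGroup.toAdelic (↥(maximalRealSubfield L)) L (IsCMField.complexConj L) 1 (JW (↥(maximalRealSubfield L)) L (-a))).range (UnitaryGroup.toAdelic (↥(maximalRealSubfield L)) L (IsCMField.complexConj L) 1 (JW (↥(maximalRealSubfield L)) L a)).range hΓ) = μW := by
    rw [hμW', Measure.map_map (measurable_cosetCongr _ _ _ hΓ he) (measurable_cosetCongr _ _ _ hΓ' hes)]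
    have hid : cosetCongr (MulEquiv.subgroupCongr hneg) (UnitaryGroup.toAdelic (↥(maximalRealSubfield L)) L (IsCMField.complexConj L) 1 (JW (↥(maximalRealSubfield L)) L (-a))).range (UnitaryGroup.toAdelic (↥(maximalRealSubfield L)) L (IsCMField.complexConj L) 1 (JW (↥(maximalRealSubfield L)) L a)).range hΓ ∘
        cosetCongr (MulEquiv.subgroupCongr hneg).symm (UnitaryGroup.toAdelic (↥(maximalRealSubfield L)) L (IsCMField.complexConj L) 1 (JW (↥(maximalRealSubfield L)) L a)).range (UnitaryGroup.toAdelic (↥(maximalRealSubfield L)) L (IsCMField.complexConj L) 1 (JW (↥(maximalRealSubfield L)) L (-a))).range hΓ' = id :=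
      funext fun q => cosetCongr_apply_symm (MulEquiv.subgroupCongr hneg) (UnitaryGroup.toAdelic (↥(maximalRealSubfield L)) L (IsCMField.complexConj L) 1 (JW (↥(maximalRealSubfield L)) L (-a))).range (UnitaryGroup.toAdelic (↥(maximalRealSubfield L)) L (IsCMField.complexConj L) 1 (JW (↥(maximalRealSubfield L)) L a)).range hΓ q
    rw [hid, Measure.map_id]
  /- STEP 4: majorants at `(−a, μ′)` and the CANONICAL clause for the partner datum at the packaged frame -/
  have hρ' := hasThetaMajorants_lineThetaKernelDatum_of_frame L ι H HodgeCM.Model.ArchSideTerm.e₁ (HodgeCM.Model.frameD (F0P2OccGenCotangentOfOccursIn.hermSpace3Of L ι H T hT hpos)) (HodgeCM.Model.frameD_real (F0P2OccGenCotangentOfOccursIn.hermSpace3Of L ι H T hT hpos)) (HodgeCM.Model.frameD_ne (F0P2OccGenCotangentOfOccursIn.hermSpace3Of L ι H T hT hpos)) (HodgeCM.Model.frameG (F0P2OccGenCotangentOfOccursIn.hermSpace3Of L ι H T hT hpos)) (HodgeCM.Model.frame_congr (F0P2OccGenCotangentOfOccursIn.hermSpace3Of L ι H T hT hpos)) hpos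 μ' hμ' (-a)
  obtain ⟨φ', j₀, hHol', hne', hE'⟩ := hcan L (InfinitePlace.mk ι).embedding H (Matrix.GeneralLinearGroup.map (starRingEnd ℂ) T) hT₀ hpos₀ hdeg hemb₀ HodgeCM.Model.ArchSideTerm.e₁ (HodgeCM.Model.frameD (F0P2OccGenCotangentOfOccursIn.hermSpace3Of L ι H T hT hpos)) (HodgeCM.Model.frameD_real (F0P2OccGenCotangentOfOccursIn.hermSpace3Of L ι H T hT hpos)) (HodgeCM.Model.frameD_ne (F0P2OccGenCotangentOfOccursIn.hermSpace3Of L ι H T hT hpos)) (HodgeCM.Model.frameG (F0P2OccGenCotangentOfOccursIn.hermSpace3Of L ι H T hT hpos)) (HodgeCM.Model.frame_congr (F0P2OccGenCotangentOfOccursIn.hermSpace3Of L ι H T hT hpos)) ιV hιV μ' hμ' hw' hι₀ (-a)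
    (⟨(Units.map ((starRingEnd ℂ : ℂ →+* ℂ) : ℂ →* ℂ)).comp χ.1, isAutomorphicOneChar_unitsMap_comp_chi (IsCMField.complexConj L) χ _⟩ : Chi (↥(maximalRealSubfield L)) L (IsCMField.complexConj L)) hadm' hρ' μW'
  /- STEP 5: the kernel law (H4b-K) and the weight match (glue) feed the conjugate transport of H4a -/
  have hθ := K2E2CapArchPairMirrorAtPKG.lineThetaKernelDatum_mirror_thetaFun (F0P2OccGenCotangentOfOccursIn.hermSpace3Of L ι H T hT hpos) μ μ' hμ hμ' a hEq hρ hρ'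
  -- the kernel law re-read over `L` (the model currency's `(cmFieldOf L).K` is `L` definitionally; one linear conversion here keeps every later step syntactic)
  have hθ' : ∀ (Φ : piSchwartzBruhat (↥(maximalRealSubfield L)) (Fin 3)) (x : ↥(UnitaryGroup.adelic (↥(maximalRealSubfield L)) L (IsCMField.complexConj L) 3 (Matrix.diagonal (HodgeCM.Model.frameD (F0P2OccGenCotangentOfOccursIn.hermSpace3Of L ι H T hT hpos))))) (y' : ↥(UnitaryGroup.adelic (↥(maximalRealSubfield L)) L (IsCMField.complexConj L) 1 (JW (↥(maximalRealSubfield L)) L (-a)))),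
      (lineThetaKernelDatum L 3 HodgeCM.Model.ArchSideTerm.e₁ (HodgeCM.Model.frameD (F0P2OccGenCotangentOfOccursIn.hermSpace3Of L ι H T hT hpos)) (HodgeCM.Model.frameD_real (F0P2OccGenCotangentOfOccursIn.hermSpace3Of L ι H T hT hpos)) (HodgeCM.Model.frameD_ne (F0P2OccGenCotangentOfOccursIn.hermSpace3Of L ι H T hT hpos)) μ' hμ' (-a) hρ').thetaFun Φ (x, y') =
        conj ((lineThetaKernelDatum L 3 HodgeCM.Model.ArchSideTerm.e₁ (HodgeCM.Model.frameD (F0P2OccGenCotangentOfOccursIn.hermSpace3Of L ι H T hT hpos)) (HodgeCM.Model.frameD_real (F0P2OccGenCotangentOfOccursIn.hermSpace3Of L ι H T hT hpos)) (HodgeCM.Model.frameD_ne (F0P2OccGenCotangentOfOccursIn.hermSpace3Of L ι H T hT hpos)) μ hμ a hρ).thetaFun (piSchwartzBruhatConj (↥(maximalRealSubfield L)) (Fin 3) Φ) (x, MulEquiv.subgroupCongr hneg y')) := hθ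
  have hf : ((star (charCM (chiQuot (↥(maximalRealSubfield L)) L (IsCMField.complexConj L) (Algebra.IsQuadraticExtension.finrank_eq_two _ L) (IsCMField.complexConj_ne_one (K := L)) (-a) (⟨(Units.map ((starRingEnd ℂ : ℂ →+* ℂ) : ℂ →* ℂ)).comp χ.1, isAutomorphicOneChar_unitsMap_comp_chi (IsCMField.complexConj L) χ _⟩ : Chi (↥(maximalRealSubfield L)) L (IsCMField.complexConj L))))).comp
        ⟨cosetCongr (MulEquiv.subgroupCongr hneg).symm (UnitaryGroup.toAdelic (↥(maximalRealSubfield L)) L (IsCMField.complexConj L) 1 (JW (↥(maximalRealSubfield L)) L a)).range (UnitaryGroup.toAdelic (↥(maximalRealSubfield L)) L (IsCMField.complexConj L) 1 (JW (↥(maximalRealSubfield L)) L (-a))).range hΓ',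
          continuous_cosetCongr (MulEquiv.subgroupCongr hneg).symm (UnitaryGroup.toAdelic (↥(maximalRealSubfield L)) L (IsCMField.complexConj L) 1 (JW (↥(maximalRealSubfield L)) L a)).range (UnitaryGroup.toAdelic (↥(maximalRealSubfield L)) L (IsCMField.complexConj L) 1 (JW (↥(maximalRealSubfield L)) L (-a))).range hΓ' hes⟩ :
        C(↥(UnitaryGroup.adelic (↥(maximalRealSubfield L)) L (IsCMField.complexConj L) 1 (JW (↥(maximalRealSubfield L)) L a)) ⧸ (UnitaryGroup.toAdelic (↥(maximalRealSubfield L)) L (IsCMField.complexConj L) 1 (JW (↥(maximalRealSubfield L)) L a)).range, ℂ)) = (charCM (chiQuot (↥(maximalRealSubfield L)) L (IsCMField.complexConj L) (Algebra.IsQuadraticExtension.finrank_eq_two _ L) (IsCMField.complexConj_ne_one (K := L)) a χ)) := by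
    ext q
    induction q using QuotientGroup.induction_on with
    | H u =>
      show star ((charCM (chiQuot (↥(maximalRealSubfield L)) L (IsCMField.complexConj L) (Algebra.IsQuadraticExtension.finrank_eq_two _ L) (IsCMField.complexConj_ne_one (K := L)) (-a)
          (⟨(Units.map ((starRingEnd ℂ : ℂ →+* ℂ) : ℂ →* ℂ)).comp χ.1, isAutomorphicOneChar_unitsMap_comp_chi (IsCMField.complexConj L) χ _⟩ : Chi (↥(maximalRealSubfield L)) L (IsCMField.complexConj L))))
        (cosetCongr (MulEquiv.subgroupCongr hneg).symm (UnitaryGroup.toAdelic (↥(maximalRealSubfield L)) L (IsCMField.complexConj L) 1 (JW (↥(maximalRealSubfield L)) L a)).range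
          (UnitaryGroup.toAdelic (↥(maximalRealSubfield L)) L (IsCMField.complexConj L) 1 (JW (↥(maximalRealSubfield L)) L (-a))).range hΓ' (QuotientGroup.mk u))) =
        (charCM (chiQuot (↥(maximalRealSubfield L)) L (IsCMField.complexConj L) (Algebra.IsQuadraticExtension.finrank_eq_two _ L) (IsCMField.complexConj_ne_one (K := L)) a χ)) (QuotientGroup.mk u)
      rw [cosetCongr_mk, K2E2CapArchPairMirrorGlue.charCM_chiQuot_neg_conj_apply, RCLike.star_def, Complex.conj_conj]
  have hlift : ∀ (Ψ : piSchwartzBruhat (↥(maximalRealSubfield L)) (Fin 3)) (x : (adelicGroupData (↥(maximalRealSubfield L)) L (IsCMField.complexConj L) 3 H).Adelic),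
      (lineThetaKernelDatum L 3 HodgeCM.Model.ArchSideTerm.e₁ (HodgeCM.Model.frameD (F0P2OccGenCotangentOfOccursIn.hermSpace3Of L ι H T hT hpos)) (HodgeCM.Model.frameD_real (F0P2OccGenCotangentOfOccursIn.hermSpace3Of L ι H T hT hpos)) (HodgeCM.Model.frameD_ne (F0P2OccGenCotangentOfOccursIn.hermSpace3Of L ι H T hT hpos)) μ' hμ' (-a) hρ').thetaLiftFun μW' Ψ (charCM (chiQuot (↥(maximalRealSubfield L)) L (IsCMField.complexConj L) (Algebra.IsQuadraticExtension.finrank_eq_two _ L) (IsCMField.complexConj_ne_one (K := L)) (-a) (⟨(Units.map ((starRingEnd ℂ : ℂ →+* ℂ) : ℂ →* ℂ)).comp χ.1, isAutomorphicOneChar_unitsMap_comp_chi (IsCMField.complexConj L) χ _⟩ : Chi (↥(maximalRealSubfield L)) L (IsCMField.complexConj L)))) ((cmAdelicFrameTransport L 3 H (HodgeCM.Model.frameD (F0P2OccGenCotangentOfOccursIn.hermSpace3Of L ι H T hT hpos)) (HodgeCM.Model.frameG (F0P2OccGenCotangentOfOccursIn.hermSpace3Of L ι H T hT hpos)) (HodgeCM.Model.frame_congr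 (F0P2OccGenCotangentOfOccursIn.hermSpace3Of L ι H T hT hpos))) x) =
        conj ((lineThetaKernelDatum L 3 HodgeCM.Model.ArchSideTerm.e₁ (HodgeCM.Model.frameD (F0P2OccGenCotangentOfOccursIn.hermSpace3Of L ι H T hT hpos)) (HodgeCM.Model.frameD_real (F0P2OccGenCotangentOfOccursIn.hermSpace3Of L ι H T hT hpos)) (HodgeCM.Model.frameD_ne (F0P2OccGenCotangentOfOccursIn.hermSpace3Of L ι H T hT hpos)) μ hμ a hρ).thetaLiftFun μW
          (piSchwartzBruhatConj (↥(maximalRealSubfield L)) (Fin 3) Ψ) (charCM (chiQuot (↥(maximalRealSubfield L)) L (IsCMField.complexConj L) (Algebra.IsQuadraticExtension.finrank_eq_two _ L) (IsCMField.complexConj_ne_one (K := L)) a χ)) ((cmAdelicFrameTransport L 3 H (HodgeCM.Model.frameD (F0P2OccGenCotangentOfOccursIn.hermSpace3Of L ι H T hT hpos)) (HodgeCM.Model.frameG (F0P2OccGenCotangentOfOccursIn.hermSpace3Of L ι H T hT hpos)) (HodgeCM.Model.frame_congr (F0P2OccGenCotangentOfOccursIn.hermSpace3Of L ι H T hT hpos)))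 x)) := fun Ψ x => by
    rw [ThetaKernelDatum.thetaLiftFun_apply, ThetaKernelDatum.thetaLiftFun_apply]
    -- (H4a §4 with its structure instances taken BY UNIFICATION from the two data — the theta-initial topology of the Schwartz carrier is
    --  not the subtype topology, so instance synthesis must not choose it; `Eq.trans` keeps the rewriting one-sided)
    refine (@K2E2CapArchPairMirrorKit.thetaLift_conj_cosetCongr_apply_map _ _ _ _ (_) _ (_) _ _ _ _ _ _ _ _ _ _ _ _ _ _ _ _ _ _
      (lineThetaKernelDatum L 3 HodgeCM.Model.ArchSideTerm.e₁ (HodgeCM.Model.frameD (F0P2OccGenCotangentOfOccursIn.hermSpace3Of L ι H T hT hpos)) (HodgeCM.Model.frameD_real (F0P2OccGenCotangentOfOccursIn.hermSpace3Of L ι H T hT hpos)) (HodgeCM.Model.frameD_ne (F0P2OccGenCotangentOfOccursIn.hermSpace3Of L ι H T hT hpos)) μ hμ a hρ) (piSchwartzBruhatConj (↥(maximalRealSubfield L)) (Fin 3)) _ _ _ _ _ _ _ μW' _ (lineThetaKernelDatum L 3 HodgeCM.Model.ArchSideTerm.e₁ (HodgeCM.Model.frameD (F0P2OccGenCotangentOfOccursIn.hermSpace3Of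 L ι H T hT hpos)) (HodgeCM.Model.frameD_real (F0P2OccGenCotangentOfOccursIn.hermSpace3Of L ι H T hT hpos)) (HodgeCM.Model.frameD_ne (F0P2OccGenCotangentOfOccursIn.hermSpace3Of L ι H T hT hpos)) μ' hμ' (-a) hρ')
      (MulEquiv.subgroupCongr hneg) hΓ he hes hθ' Ψ (charCM (chiQuot (↥(maximalRealSubfield L)) L (IsCMField.complexConj L) (Algebra.IsQuadraticExtension.finrank_eq_two _ L) (IsCMField.complexConj_ne_one (K := L)) (-a) (⟨(Units.map ((starRingEnd ℂ : ℂ →+* ℂ) : ℂ →* ℂ)).comp χ.1, isAutomorphicOneChar_unitsMap_comp_chi (IsCMField.complexConj L) χ _⟩ : Chi (↥(maximalRealSubfield L)) L (IsCMField.complexConj L)))) _).trans ?_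
    rw [hback, hf]
  /- STEP 6: the witnesses `φ := C_∞ ∘ φ′`, `j₀` -/
  refine ⟨fun j => schwartzConj (φ' j), j₀, ?_, ?_, ?_⟩
  · -- (HOLCOT): the theta pair of `(C_∞φ′_j, Φ_f)` is `conj` of the partner's pair of `(φ′_j, C_fΦ_f)`, holomorphic at `(ι₀, T̄)`; pull back along `id` (★ caseD pattern)
    intro Φf
    have hmem := hHol' (finSBConj Φf)
    have hrel : ∀ u : U21, (MonoidHom.id (adelicGroupData (↥(maximalRealSubfield L)) L (IsCMField.complexConj L) 3 H).Adelic) (cmArchSection L ι H T hT u) =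
        cmArchSection L (InfinitePlace.mk ι).embedding H (Matrix.GeneralLinearGroup.map (starRingEnd ℂ) T) hT₀ (conjU21 u) := fun u => by
      rw [MonoidHom.id_apply]; exact cmArchSection_eq_conjU21 L ι H T hT hne hT₀ u
    have hK : ∀ k ∈ cmCompactFactor L ι H T hT, (MonoidHom.id _) k ∈ cmCompactFactor L (InfinitePlace.mk ι).embedding H (Matrix.GeneralLinearGroup.map (starRingEnd ℂ) T) hT₀ :=
      fun k hk => by rw [MonoidHom.id_apply, ← cmCompactFactor_eq_of_embedding L ι H T hT _ hT₀]; exact hk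
    have hconj := conjFun_comp_mem_holCotForms_of_conj (κ := MonoidHom.id _) (κf := MonoidHom.id _) hrel (fun γ hγ => hγ) hK
      (fun g => rfl) continuous_id hmem
    refine (congrArg (· ∈ _) (funext fun x => funext fun j => ?_)).mpr hconj
    have h1 := hlift (piSBReindex (↥(maximalRealSubfield L)) HodgeCM.Model.ArchSideTerm.e₁ (piSchwartzBruhatEquiv (↥(maximalRealSubfield L)) (Fin 3 × Fin 1) (φ' j ⊗ₜ[ℂ] finSBConj Φf))) x
    rw [piSchwartzBruhatConj_piSBReindex, piSchwartzBruhatConj_equiv_tmul, finSBConj_finSBConj] at h1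
    rw [CotangentForms.conjFun_apply, MonoidHom.id_apply, Pi.star_apply, RCLike.star_def]
    exact ((congrArg (starRingEnd ℂ) h1).trans (Complex.conj_conj _)).symm
  · -- `R^∞_{e₁} (C_∞ φ′_{j₀}) = C_∞ (R^∞_{e₁} φ′_{j₀}) ≠ 0`
    rw [← K2E2CapArchPairMirrorGlue.schwartzConj_schwartzReindexCLM, Ne, K2E2CapArchPairMirrorGlue.schwartzConj_eq_zero_iff]
    exact hne'
  · -- (E): partner-fixed ⇒ original fixes the conjugate vector (H4b-K §2 over H4a §2), at `ȳ′ := a′` read in `U(J_W(−a))(L⁺ ⊗ ℝ)`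
    intro a'
    have harch : UnitaryGroup.arch (↥(maximalRealSubfield L)) L (IsCMField.complexConj L) 1 (JW (↥(maximalRealSubfield L)) L (-a)) = UnitaryGroup.arch (↥(maximalRealSubfield L)) L (IsCMField.complexConj L) 1 (JW (↥(maximalRealSubfield L)) L a) := by
      rw [Summit.HodgeConjecture.CorCM.HComp.OmegaConj.JW_neg, K2E2CapArchPairMirrorKit.arch_neg]
    rw [← K2E2CapArchPairMirrorGlue.schwartzConj_schwartzReindexCLM]
    exact K2E2CapArchPairMirrorAtPKG.archWeilRep_line_schwartzConj_eq_self_of_partner (F0P2OccGenCotangentOfOccursIn.hermSpace3Of L ι H T hT hpos) μ μ' hμ hμ' a hEq a' (MulEquiv.subgroupCongr harch.symm a')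
      (MulEquiv.subgroupCongr_apply _ _) (hE' (MulEquiv.subgroupCongr harch.symm a'))

end Summit.HodgeConjecture.HodgeConjecture.Cruxes.H413.K2E2CapArchPairMirror

end
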